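import Summits.AtomisticToContinuum.Crystallization.Theorems.ExcessDecayLiouvillePhononStabilityCertChart

/-!
# Near-certificate layer VIII: proof of the chart identities

Support file for crux `PhononStability` (line `contragredient-window-collapse`): the directional / metric /
plain class functionals as pair forms in covariant coordinates (from the basis expansions of the frame file),
and the packaged `ChartIdentities`. [folklore]
-/

noncomputable section

open scoped BigOperators Classical InnerProductSpace
open Filter Set Function
open Summit.AtomisticToContinuum.Crystallization.Theorems.PhononStabilityNegative
open Literature.MathematicalPhysics.StatisticalMechanics

namespace Summit.AtomisticToContinuum.Crystallization.Theorems.PhononStabilityCWC.Cert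


/-- **(iii) directional functionals as pair forms:** `Σ_k ⟪v, Δ_s w k⟫² = pair(s, v̂ v̂ᵀ)(w)`. [folklore] -/
theorem dirForm_eq_pairEvalR (v : (EuclideanSpace ℝ (Fin 3))) (s : BondClass) (w : Label → (EuclideanSpace ℝ (Fin 3))) :
    (∑' k, (inner ℝ v (bondDiff s w k)) ^ 2) = pairEvalR s (fun i j => contraOf v i * contraOf v j) w := by
  unfold pairEvalR
  refine tsum_congr fun k => ?_
  rw [bilR_outer, inner_eq_sum_contra_cov]
  rfl

/-- `‖B x‖² = x̃ᵀ Ĥ x̃`. [folklore] -/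
theorem norm_sq_metric_chart (B : (EuclideanSpace ℝ (Fin 3)) →L[ℝ] (EuclideanSpace ℝ (Fin 3))) (x : (EuclideanSpace ℝ (Fin 3))) :
    ‖B x‖ ^ 2 = bilR (hhat B) (covOf x) (covOf x) := by
  have hx : B x = ∑ i, covOf x i • B (dgen i) := by
    conv_lhs => rw [expand_cov x]
    simp [map_sum, map_smul]
  rw [← real_inner_self_eq_norm_sq, hx, sum_inner, bilR]
  refine Finset.sum_congr rfl fun i _ => ?_
  rw [inner_sum]
  refine Finset.sum_congr rfl fun j _ => ?_
  rw [real_inner_smul_left, real_inner_smul_right, hhat]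
  ring

/-- **(iv) metric functionals as pair forms:** `Σ_k ‖B Δ_c w k‖² = pair(c, Ĥ)(w)`. [folklore] -/
theorem metricForm_eq_pairEvalR (B : (EuclideanSpace ℝ (Fin 3)) →L[ℝ] (EuclideanSpace ℝ (Fin 3))) (c : BondClass) (w : Label → (EuclideanSpace ℝ (Fin 3))) :
    metricForm B c w = pairEvalR c (hhat B) w := by
  unfold metricForm pairEvalR covDiff
  exact tsum_congr fun k => norm_sq_metric_chart B _

/-- **(v)** `pair(c, Ĥ)(w) ≥ 0`. [folklore] -/
theorem pairEvalR_hhat_nonneg (B : (EuclideanSpace ℝ (Fin 3)) →L[ℝ] (EuclideanSpace ℝ (Fin 3))) (c : BondClass) (w : Label → (EuclideanSpace ℝ (Fin 3))) : 0 ≤ pairEvalR c (hhat B) w := by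
  rw [← metricForm_eq_pairEvalR]
  exact tsum_nonneg fun k => by positivity

/-- `‖x‖² = x̃ᵀ M₀⁻¹ x̃`. [folklore] -/
theorem norm_sq_plain_chart (x : (EuclideanSpace ℝ (Fin 3))) : ‖x‖ ^ 2 = bilR (fun i j => (M0inv i j : ℝ)) (covOf x) (covOf x) := by
  have hx : x = ∑ i, covOf x i • dgen i := expand_cov x
  rw [← real_inner_self_eq_norm_sq]
  conv_lhs => rw [hx]
  rw [sum_inner, bilR]
  refine Finset.sum_congr rfl fun i _ => ?_
  rw [inner_sum]
  refine Finset.sum_congr rfl fun j _ => ?_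
  rw [real_inner_smul_left, real_inner_smul_right, inner_dgen]
  ring

/-- **(vi) plain functionals as pair forms:** `Σ_k ‖Δ_c w k‖² = pair(c, M₀⁻¹)(w)`. [folklore] -/
theorem plainForm_eq_pairEvalR (c : BondClass) (w : Label → (EuclideanSpace ℝ (Fin 3))) :
    plainForm c w = pairEvalR c (fun i j => (M0inv i j : ℝ)) w := by
  unfold plainForm pairEvalR covDiff
  exact tsum_congr fun k => norm_sq_plain_chart _

/-- **THE CHART IDENTITIES HOLD.** [folklore] -/
theorem chartIdentities : ChartIdentities :=
  ⟨norm_sq_bondVec_chart, contraOf_bondVec, dirForm_eq_pairEvalR, metricForm_eq_pairEvalR, pairEvalR_hhat_nonneg,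
    plainForm_eq_pairEvalR⟩

/-- Anchor of this support file (registered stub of the line skeleton). -/
theorem stub_certChartId : ChartIdentities := chartIdentities

end Summit.AtomisticToContinuum.Crystallization.Theorems.PhononStabilityCWC.Cert

end
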